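import Literature.Topology.FourManifolds.LatticeFormsPolarisationStabiliserStable
import Literature.Topology.FourManifolds.LatticeFormsL2tDiscriminantForm
import HarnessLib

/-!
# `O(L_{2t}, h_d)/Õ(L_{2t}, h_d) ≅ {x mod 2t : x² ≡ 1 (mod 4t), x ≡ 1 (mod f)}` for every divisor `f = div(h_d)`, and its
# order `2^{ρ(t/f)}` (`f` odd) ∕ `2^{ρ(2t/f)}` (`f` even) when `w = 1`
# (Gritsenko–Hulek–Sankaran, *Compositio Math.* 146 (2010), §4 Prop. 4.12 (ii))

Trunk T-4MAN vocabulary; sequel of `LatticeFormsPolarisationStabiliserStable.lean` (row g44-#11: the stabiliser of a primitive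
`h ∈ L = B₀ ⊕ ⟨−2t⟩` with `f ∣ (h, L)` acts on `A_L ≅ ℤ/2t` by `x ↦ sx`, `s² ≡ 1 (mod 4t)`, `s ≡ 1 (mod f)`), of
`LatticeFormsPolarisationTypesOrthogonalOrbits.lean` (g44-#1: every such `s` is the action of some `g ∈ O(L)`), of
`LatticeFormsNegTwoDVectorOrbitCount.lean` (g41: Eichler's criterion `exists_stable_isometryEquiv_apply_eq_iff_dvd_snd_sub_snd`),
of `LatticeFormsL2tDiscriminantForm.lean` (g44-#7: `A_L ⥲ ℤ/2t`, `[l_t^*] ↦ 1`) and of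
`LatticeFormsRankOneDiscriminantFormIsometries.lean` (g39: `#{u mod 2n : u² ≡ 1 (4n)} = 2^{ρ(n)}`,
`#{y mod m : y² = 1} = 2^{ρ(m)}` for odd `m`). Written for lane `lit-hodgefound` (Track 2 foundations; prover seat
`lit-hodgefound-p18`, gen 44, row g44-#13). THEOREMS ONLY — no definition, no named fact, no instance, no notation.

## Source, verbatim (V. Gritsenko, K. Hulek, G. K. Sankaran, Compositio Math. 146 (2010) 404–434, arXiv numbering §4,
held text `paper:arxiv-0802.2078` pp. 12–13)

"**Proposition 4.12.** Let `h_d ∈ L_{2t}` be a primitive vector such that `h_d² = 2d` and `div(h_d) = f`. Assume that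
`w = 1`, i.e. `f` and `(2t/f, 2d/f)` are coprime. Then (i) `Õ(L_{2t}, h_d) ≅ Õ((h_d)^⊥_{L_{2t}})`. (ii) The factor group
`O(L_{2t}, h_d)/Õ(L_{2t}, h_d)` is an abelian `2`-group, which is of order `2^{ρ(t/f)}` if `f` is odd. If `f` is even the
order is equal to `2^{ρ(2t/f)+δ}`, where `δ = 0` if `(2t/f) ≡ 1 mod 2` or `(2t/f) ≡ 4 mod 8`, `δ = −1` if `(2t/f) ≡ 2 mod 4`,
`δ = 1` if `(2t/f) ≡ 0 mod 8`. *Proof.* […] We note that the natural projection `O(h_d^⊥) → O(D(L_B))` is surjective (see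
[Nik]). Therefore […] `O(L_{2t}, h_d)/Õ(L_{2t}, h_d) ≅ {γ ∈ O(h_d^⊥) ∣ γ̄|_{p(H)} = id}/Õ(h_d^⊥) ≅ O(⟨k̄₃⟩)`, where
`⟨k̄₃⟩ = {n k̄₃ ∣ n mod 2t/f}` and `k̄₃² ≡ −f²/2t mod 2`. Therefore
`O(⟨k̄₃⟩) ≅ {x mod 2t/f ∣ x² k̄₃² ≡ k̄₃² mod 2} = {x mod 2t/f ∣ x²f ≡ f mod 2·2t/f}`. We supposed that `w = 1`. Therefore
`f = f₁` and `g = g₁` are coprime. We have `2t/f = g₁t₁` with `(f₁, t₁) = 1` (see Proposition 4.6). It follows that the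
group `O(⟨k̄₃⟩)` is isomorphic to the group `{x mod 2t/f ∣ x² ≡ 1 mod 2^{ε(f)} 2t/f}`, where `ε(f) = 1` if `f` is odd (in
this case `2t/f` is even) and `ε(f) = 0` is `f` is even. The last group is well-known (compare with [GH]). □"

## Reading notes

* ABSTRACTION as in the predecessor files: `L = B₀ ⊕ ⟨−2t⟩` with `B₀` symmetric even unimodular containing two orthogonal
  hyperbolic pairs (`3U ⊕ 2E₈(−1)` is the printed `B₀`), `t ≥ 1`; "`div(h) = f`" is "`f ∣ (h, z)` for all `z` and
  `(h, h') = f` for some `h'`"; "primitive" is "`h ≠ 0` and `ℤh` saturated". No group structure is declared: the "factor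
  group `O(L_{2t}, h_d)/Õ(L_{2t}, h_d)`" is the set of classes of the stabiliser `{g ∈ O(L) : g h = h}` modulo "same action
  on `A_L`" (two stabiliser elements induce the same `ḡ` iff they differ by an element of `Õ(L, h) = Õ(L) ∩ O(L, h)`), and
  its "order" is the `Nat.card` of that quotient; "abelian `2`-group" is not stated.
* THE PROOF HERE IS NOT THE PRINTED ONE, and needs neither `w = 1` nor the basis `k̄₁, k̄₃` of `D(h_d^⊥)`: by the proof of
  Cor. 4.7, `O(L) → O(A_L) ≅ {x mod 2t : x² ≡ 1 (4t)}` is onto (row g44-#1), an element `x ↦ sx` lies in the image of the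
  stabiliser iff `s ≡ 1 (mod f)` — necessity is row g44-#11; sufficiency (§1): lift `s` to `g₀ ∈ O(L)`, then `g₀h` has the
  invariants of `h` and `l_t`-coordinate `≡ sc ≡ c (mod f)`, so Eichler's criterion (Prop. 4.6: the `Õ(L)`-orbit is
  determined by `c mod f`) gives `g₁ ∈ Õ(L)` with `g₁g₀h = h`. Hence (§2)
  `O(L, h)/Õ(L, h) ≅ S_f := {x mod 2t : x² ≡ 1 (mod 4t), x ≡ 1 (mod f)}` for EVERY primitive `h` with `div(h) = f` — this set
  is the printed `O(⟨k̄₃⟩) = {x mod 2t/f ∣ x²f ≡ f mod 2·2t/f}` re-indexed (`x mod 2t ↦ x mod 2t/f` is a bijection on it when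
  `(f, 2t/f) = 1`, §3). The counts (§3–§4) are then `2^{ρ(t/f)}` for `f` odd and `2^{ρ(2t/f)}` for `f` even, under
  `(f, 2t/f) = 1`.
* ON `w = 1` AND `δ`: for a type `(2d, f)` that occurs, `w = ((2t/f, 2d/f), f)` equals `(f, 2t/f)` (`gcd_eq_one_of_w_eq_one` ∕
  `w_eq_one_of_gcd_eq_one`, row g44-#1, give the case `= 1`); so under `w = 1` an even `f` forces `2t/f` odd and the
  printed `δ` is `0` — the sub-cases `δ = ±1` of (ii) do not occur under the proposition's own hypothesis. They are not
  restated. TODO(general form): the order for `(f, 2t/f) > 1` (i.e. `w > 1`), where §2 still applies but §3 does not.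

## Contents (all proved)

* §1 **`exists_isometryEquiv_apply_eq_and_discriminantGroupCongr_eq_zsmul`**: every `s` with `s² ≡ 1 (mod 4t)`,
  `s ≡ 1 (mod f)` is the action on `A_L` of an isometry FIXING `h` (`f ∣ (h, L)`, `(h, h') = f`).
* §2 **`natCard_quot_stabiliser_discriminantGroupCongr_eq`**: `|O(L, h)/Õ(L, h)| = #S_f`,
  `S_f = {x ∈ ℤ/2t : 4t ∣ x² − 1, f ∣ x − 1}` (lifts `x = val`), for every primitive `h` with `div(h) = f`.
* §3 arithmetic: `natCard_sf_eq_two_pow_of_odd` (`f` odd, `(f, 2t/f) = 1`: `#S_f = 2^{ρ(t/f)}`) and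
  `natCard_sf_eq_two_pow_of_even` (`f = 2n`, `(f, 2t/f) = 1`: `#S_f = 2^{ρ(t/n)}`, `t/n = 2t/f`).
* §4 Prop. 4.12 (ii): **`natCard_quot_stabiliser_discriminantGroupCongr_eq_two_pow_of_odd`** (`2^{ρ(t/f)}`) and
  **`natCard_quot_stabiliser_discriminantGroupCongr_eq_two_pow_of_even`** (`2^{ρ(2t/f)}`), under the printed `w = 1`.
* §5 the models `(E₈(−1)^{⊕m} ⊕ U^{⊕(k+2)}) ⊕ ℤ(−2t)` (`L_{2t}`: `m = 2`, `k = 1`).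

## References

* [GritsenkoHulekSankaran2010Symplectic] V. Gritsenko, K. Hulek, G. K. Sankaran, Moduli spaces of irreducible symplectic
  manifolds, Compositio Math. 146 (2010) 404–434 (arXiv:0802.2078): §4 Prop. 4.12 (ii) with its proof, proof of Cor. 4.7,
  Prop. 4.6.
* [GritsenkoHulek1998] V. Gritsenko, K. Hulek, Minimal Siegel modular threefolds, Math. Proc. Cambridge Philos. Soc. 123
  (1998) 461–485 (GHS's [GH]).
* [Nikulin1980] V. V. Nikulin, Integral symmetric bilinear forms and some of their applications, Math. USSR Izv. 14 (1980):
  Thm. 1.14.2 (GHS's [Nik]).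
* [GritsenkoHulekSankaran2007HM] V. Gritsenko, K. Hulek, G. K. Sankaran, The Hirzebruch–Mumford volume for the orthogonal
  group and applications, Doc. Math. 12 (2007): §4 proof of Lemma 4.3 (`#{x mod 2d : x² ≡ 1 mod 4d} = 2^{ρ(d)}`).
-/

noncomputable section

open Module Function
open LinearMap (BilinForm)
open LinearMap.BilinForm

namespace Literature.Topology.FourManifolds

universe u

/-! ### §1 Every `s ≡ 1 (mod f)` with `s² ≡ 1 (mod 4t)` is realised by an isometry fixing `h` -/

section Surjective

variable {M : Type u} [AddCommGroup M] [Module.Finite ℤ M] [Module.Free ℤ M] {B₀ : BilinForm ℤ M} (t : ℕ)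

/-- **The image of the stabiliser `O(L, h)` in `O(A_L)` contains every `x ↦ sx` with `s² ≡ 1 (mod 4t)`, `s ≡ 1 (mod f)`**
(`L = B₀ ⊕ ⟨−2t⟩`, `B₀` even unimodular with two orthogonal hyperbolic pairs, `t ≥ 1`; `f ∣ (h, L)`, `(h, h') = f`): lift `s`
to `g₀ ∈ O(L)` ("`O(L_{2t}) → O(D(L_{2t}))` is surjective"), then `g₀h` and `h` have the same square, the same divisor data
and `l_t`-coordinates `≡ sc ≡ c (mod f)`, so they are `Õ(L)`-equivalent (Eichler's criterion, Prop. 4.6: "the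
`Õ(L_{2t})`-orbit of `h_d` is … determined by `c mod f`"); composing gives an isometry fixing `h` with action `s`.
[cite: GritsenkoHulekSankaran2010Symplectic, §4 proof of Cor. 4.7 and proof of Prop. 4.6] [cite: Nikulin1980, Thm. 1.14.2] -/
theorem exists_isometryEquiv_apply_eq_and_discriminantGroupCongr_eq_zsmul (hu : B₀.IsUnimodular) (he : B₀.IsEven)
    (ht : 0 < t) {x y x₁ y₁ : M} (hP : TwoHyperbolicPairs B₀ x y x₁ y₁) {r r' : M × ℤ} {f : ℤ} (hf0 : f ≠ 0)
    (hfr : ∀ z, f ∣ B₀.prod ((-(2 * t : ℤ)) • LinearMap.mul ℤ ℤ) r z)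
    (hr' : B₀.prod ((-(2 * t : ℤ)) • LinearMap.mul ℤ ℤ) r r' = f) {s : ℤ} (hs : (4 * t : ℤ) ∣ s ^ 2 - 1)
    (hsf : f ∣ s - 1) :
    ∃ g : (B₀.prod ((-(2 * t : ℤ)) • LinearMap.mul ℤ ℤ)).IsometryEquiv (B₀.prod ((-(2 * t : ℤ)) • LinearMap.mul ℤ ℤ)),
      g r = r ∧ ∀ a, g.discriminantGroupCongr a = s • a := by
  obtain ⟨g₀, hg₀⟩ := exists_isometryEquiv_discriminantGroupCongr_eq_zsmul t hu he ht hP hs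
  have h1 : f ∣ (g₀ r).2 - r.2 := by
    have h2 := dvd_snd_apply_sub_mul_snd_of_discriminantGroupCongr_eq_zsmul t hu ht g₀ hg₀ hf0 hfr
    rw [show (g₀ r).2 - r.2 = ((g₀ r).2 - s * r.2) + (s - 1) * r.2 by ring]
    exact dvd_add h2 (hsf.mul_right _)
  obtain ⟨g₁, hg₁, hg₁r⟩ := (exists_stable_isometryEquiv_apply_eq_iff_dvd_snd_sub_snd t hu he ht hP hf0
    (g₀.map_app r r) ((forall_dvd_apply_iff_of_isometryEquiv g₀ r f).2 hfr) hfr (u' := g₀ r') (v' := r')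
    (by rw [g₀.map_app, hr']) hr').2 h1
  refine ⟨g₀.trans g₁, hg₁r, fun a ↦ ?_⟩
  rw [IsometryEquiv.discriminantGroupCongr_trans, LinearEquiv.trans_apply, hg₀, hg₁, LinearEquiv.refl_apply]

end Surjective

/-! ### §2 `O(L, h)/Õ(L, h) ≅ S_f = {x mod 2t : x² ≡ 1 (mod 4t), x ≡ 1 (mod f)}` for every primitive `h` with `div(h) = f` -/

section Quotient

variable {M : Type u} [AddCommGroup M] [Module.Finite ℤ M] [Module.Free ℤ M] {B₀ : BilinForm ℤ M} (t : ℕ)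

/-- **Prop. 4.12 (ii), the quotient: `|O(L, h)/Õ(L, h)| = #{x mod 2t : x² ≡ 1 (mod 4t), x ≡ 1 (mod f)}`** for EVERY primitive
`h ∈ L = B₀ ⊕ ⟨−2t⟩` with `(h, L) = fℤ` (`f ≥ 1`) — the classes of the stabiliser `{g ∈ O(L) : g h = h}` modulo equal action
on `A_L` correspond, via `ḡ = (x ↦ sx) ↦ s mod 2t`, to that set ("`O(L_{2t}, h_d)/Õ(L_{2t}, h_d) ≅ … ≅ O(⟨k̄₃⟩) ≅
{x mod 2t/f ∣ x²f ≡ f mod 2·2t/f}`", here indexed mod `2t`; no hypothesis `w = 1`). `B₀` symmetric even unimodular with two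
orthogonal hyperbolic pairs, `t ≥ 1`. [cite: GritsenkoHulekSankaran2010Symplectic, §4 Prop. 4.12 (ii) and proof] [cite: Nikulin1980, Thm. 1.14.2] -/
theorem natCard_quot_stabiliser_discriminantGroupCongr_eq (hu : B₀.IsUnimodular) (hs₀ : B₀.IsSymm) (he : B₀.IsEven)
    (ht : 0 < t) {x y x₁ y₁ : M} (hP : TwoHyperbolicPairs B₀ x y x₁ y₁) {r r' : M × ℤ} {f : ℤ} (hf0 : f ≠ 0)
    (hr0 : r ≠ 0) (hsat : ∀ (k : ℤ) (w : M × ℤ), k ≠ 0 → k • w ∈ ℤ ∙ r → w ∈ ℤ ∙ r)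
    (hfr : ∀ z, f ∣ B₀.prod ((-(2 * t : ℤ)) • LinearMap.mul ℤ ℤ) r z)
    (hr' : B₀.prod ((-(2 * t : ℤ)) • LinearMap.mul ℤ ℤ) r r' = f) :
    Nat.card (Quot fun g g' : {g : (B₀.prod ((-(2 * t : ℤ)) • LinearMap.mul ℤ ℤ)).IsometryEquiv
        (B₀.prod ((-(2 * t : ℤ)) • LinearMap.mul ℤ ℤ)) // g r = r} ↦
        g.1.discriminantGroupCongr = g'.1.discriminantGroupCongr) =
      Nat.card {σ : ZMod (2 * t) // (4 * t : ℤ) ∣ (σ.val : ℤ) ^ 2 - 1 ∧ f ∣ (σ.val : ℤ) - 1} := by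
  haveI : NeZero (2 * t) := ⟨by omega⟩
  haveI : Module.IsTorsionFree ℤ M := inferInstance
  -- `f ∣ 2t`: `f ∣ (h, l_t) = −2tc` with `(f, c) = 1`
  have hft : f ∣ 2 * t := by
    have h1 : f ∣ 2 * t * r.2 := by
      have h2 := hfr ((0 : M), (1 : ℤ))
      rw [prod_neg_twoMul_smul_mul_apply, map_zero, mul_one, zero_sub, dvd_neg] at h2
      exact h2
    exact Int.dvd_of_dvd_mul_left_of_gcd_one h1 (gcd_snd_eq_one_of_primitive_of_forall_dvd t hu hr0 hsat hfr)
  obtain ⟨e, hemk, -⟩ := exists_addMonoidHom_discriminantGroup_zmod t hu ht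
  have heγ : ∀ s : ℤ, e (s • Submodule.Quotient.mk (LinearMap.snd ℤ M ℤ)) = (s : ZMod (2 * t)) := fun s ↦ by
    rw [map_zsmul, hemk, LinearMap.snd_apply, zsmul_eq_mul, Int.cast_one, mul_one]
  -- the action `s_g` of a stabiliser element, and its residue `mod 2t`
  have hact : ∀ g : {g : (B₀.prod ((-(2 * t : ℤ)) • LinearMap.mul ℤ ℤ)).IsometryEquiv
      (B₀.prod ((-(2 * t : ℤ)) • LinearMap.mul ℤ ℤ)) // g r = r},
      ∃ s : ℤ, (4 * t : ℤ) ∣ s ^ 2 - 1 ∧ f ∣ s - 1 ∧ ∀ a, g.1.discriminantGroupCongr a = s • a := fun g ↦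
    exists_int_discriminantGroupCongr_eq_zsmul_of_apply_eq t hu hs₀ he ht g.1 hf0 hr0 hsat hfr g.2
  -- conditions on `s` pass to the canonical lift of `s mod 2t`
  have hval : ∀ s : ℤ, (2 * t : ℤ) ∣ (((s : ZMod (2 * t)).val : ℤ)) - s := fun s ↦ by
    have h1 : ((((s : ZMod (2 * t)).val : ℤ) : ZMod (2 * t))) = ((s : ℤ) : ZMod (2 * t)) := by
      rw [Int.cast_natCast, ZMod.natCast_zmod_val]
    exact_mod_cast (ZMod.intCast_eq_intCast_iff_dvd_sub _ _ (2 * t)).1 h1.symm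
  have hcond : ∀ s : ℤ, (4 * t : ℤ) ∣ s ^ 2 - 1 → f ∣ s - 1 →
      (4 * t : ℤ) ∣ (((s : ZMod (2 * t)).val : ℤ)) ^ 2 - 1 ∧ f ∣ (((s : ZMod (2 * t)).val : ℤ)) - 1 := by
    intro s hs hsf
    refine ⟨?_, ?_⟩
    · have h1 := four_mul_dvd_sq_sub_sq_of_dvd_sub (hval s)
      have e1 : (((s : ZMod (2 * t)).val : ℤ)) ^ 2 - 1 = ((((s : ZMod (2 * t)).val : ℤ)) ^ 2 - s ^ 2) + (s ^ 2 - 1) := by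
        ring
      rw [e1]
      exact dvd_add h1 hs
    · have e1 : (((s : ZMod (2 * t)).val : ℤ)) - 1 = ((((s : ZMod (2 * t)).val : ℤ)) - s) + (s - 1) := by ring
      rw [e1]
      exact dvd_add (hft.trans (hval s)) hsf
  -- the invariant `Φ(g) = e(ḡ γ)`, `γ = [l_t^*]`
  let Φ : {g : (B₀.prod ((-(2 * t : ℤ)) • LinearMap.mul ℤ ℤ)).IsometryEquiv
      (B₀.prod ((-(2 * t : ℤ)) • LinearMap.mul ℤ ℤ)) // g r = r} → ZMod (2 * t) :=
    fun g ↦ e (g.1.discriminantGroupCongr (Submodule.Quotient.mk (LinearMap.snd ℤ M ℤ)))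
  have hΦ : ∀ g (s : ℤ), (∀ a, g.1.discriminantGroupCongr a = s • a) → Φ g = (s : ZMod (2 * t)) := fun g s hg ↦ by
    change e (g.1.discriminantGroupCongr (Submodule.Quotient.mk (LinearMap.snd ℤ M ℤ))) = _
    rw [hg, heγ]
  have hΦmem : ∀ g, (4 * t : ℤ) ∣ ((Φ g).val : ℤ) ^ 2 - 1 ∧ f ∣ ((Φ g).val : ℤ) - 1 := fun g ↦ by
    obtain ⟨s, hs, hsf, hg⟩ := hact g
    rw [hΦ g s hg]
    exact hcond s hs hsf
  -- `Φ g = Φ g'` iff `ḡ = ḡ'`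
  have hΦinj : ∀ g g', Φ g = Φ g' ↔ g.1.discriminantGroupCongr = g'.1.discriminantGroupCongr := by
    intro g g'
    obtain ⟨s, -, -, hg⟩ := hact g
    obtain ⟨s', -, -, hg'⟩ := hact g'
    rw [hΦ g s hg, hΦ g' s' hg', ZMod.intCast_eq_intCast_iff_dvd_sub, dvd_sub_comm, Nat.cast_mul, Nat.cast_ofNat,
      ← forall_zsmul_eq_zsmul_iff_prod_neg_twoMul t hu s s']
    exact ⟨fun h ↦ LinearEquiv.ext fun a ↦ by rw [hg, hg', h a], fun h a ↦ by rw [← hg, ← hg', h]⟩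
  refine Nat.card_congr (Equiv.ofBijective
    (Quot.lift (fun g ↦ (⟨Φ g, hΦmem g⟩ : {σ : ZMod (2 * t) // (4 * t : ℤ) ∣ (σ.val : ℤ) ^ 2 - 1 ∧
      f ∣ (σ.val : ℤ) - 1})) fun g g' hgg' ↦ Subtype.ext ((hΦinj g g').2 hgg')) ⟨?_, ?_⟩)
  · rintro ⟨g⟩ ⟨g'⟩ hgg'
    exact Quot.sound ((hΦinj g g').1 (congr_arg Subtype.val hgg'))
  · rintro ⟨σ, hσ, hσf⟩
    obtain ⟨g, hgr, hg⟩ := exists_isometryEquiv_apply_eq_and_discriminantGroupCongr_eq_zsmul t hu he ht hP hf0 hfr hr'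
      hσ hσf
    refine ⟨Quot.mk _ ⟨g, hgr⟩, Subtype.ext ?_⟩
    change Φ ⟨g, hgr⟩ = σ
    rw [hΦ ⟨g, hgr⟩ _ hg, Int.cast_natCast, ZMod.natCast_zmod_val]

end Quotient

/-! ### §3 `#S_f`: `2^{ρ(t/f)}` for `f` odd, `2^{ρ(2t/f)}` for `f` even, when `(f, 2t/f) = 1` ("the last group is well-known") -/

section Arithmetic

/-- The canonical lift of `a mod n` is congruent to `a`. [folklore] -/
private theorem natCast_dvd_val_intCast_sub (n : ℕ) [NeZero n] (a : ℤ) : (n : ℤ) ∣ (((a : ZMod n)).val : ℤ) - a := by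
  have h1 : ((((a : ZMod n)).val : ℤ) : ZMod n) = ((a : ℤ) : ZMod n) := by rw [Int.cast_natCast, ZMod.natCast_zmod_val]
  exact (ZMod.intCast_eq_intCast_iff_dvd_sub _ _ n).1 h1.symm

/-- Two residues `mod n` with congruent canonical lifts are equal. [folklore] -/
private theorem eq_of_dvd_val_sub_val (n : ℕ) [NeZero n] {σ₁ σ₂ : ZMod n} (h : (n : ℤ) ∣ (σ₂.val : ℤ) - σ₁.val) :
    σ₁ = σ₂ := by
  have h1 := (ZMod.intCast_eq_intCast_iff_dvd_sub (σ₁.val : ℤ) (σ₂.val : ℤ) n).2 h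
  rwa [Int.cast_natCast, ZMod.natCast_zmod_val, Int.cast_natCast, ZMod.natCast_zmod_val] at h1

/-- **`#{x mod 2t : x² ≡ 1 (mod 4t), x ≡ 1 (mod f)} = 2^{ρ(t/f)}` for `f` odd with `f ∣ 2t`, `(f, 2t/f) = 1`** (then
`t = ft'`, and `x mod 2t ↦ x mod 2t'` is a bijection onto `{u mod 2t' : u² ≡ 1 (mod 4t')}`, of cardinality `2^{ρ(t')}`:
"`{x mod 2t/f ∣ x² ≡ 1 mod 2^{ε(f)} 2t/f}`, `ε(f) = 1` if `f` is odd … The last group is well-known").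
[cite: GritsenkoHulekSankaran2010Symplectic, §4 proof of Prop. 4.12 (ii)] [cite: GritsenkoHulekSankaran2007HM, §4 proof of Lemma 4.3] -/
theorem natCard_sf_eq_two_pow_of_odd {t f : ℕ} (ht : 0 < t) (hfo : Odd f) (hft : (f : ℤ) ∣ 2 * t)
    (hcop : Int.gcd (f : ℤ) (2 * t / f) = 1) :
    Nat.card {σ : ZMod (2 * t) // (4 * t : ℤ) ∣ (σ.val : ℤ) ^ 2 - 1 ∧ (f : ℤ) ∣ (σ.val : ℤ) - 1} =
      2 ^ (t / f).primeFactors.card := by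
  obtain ⟨k, hk⟩ := hfo
  haveI : NeZero (2 * t) := ⟨by omega⟩
  have hf0 : (f : ℤ) ≠ 0 := by exact_mod_cast (show f ≠ 0 by omega)
  -- `t = f t'`, `2t/f = 2t'`, `(f, 2t') = 1`, `(f, 4t') = 1`
  have hf2 : IsCoprime (f : ℤ) 2 := ⟨1, -(k : ℤ), by rw [hk]; push_cast; ring⟩
  obtain ⟨t', ht'⟩ : f ∣ t := by exact_mod_cast (hf2.dvd_of_dvd_mul_left hft : (f : ℤ) ∣ t)
  have ht'0 : 0 < t' := Nat.pos_of_mul_pos_left (ht' ▸ ht)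
  haveI : NeZero (2 * t') := ⟨by omega⟩
  have hdiv : 2 * (t : ℤ) / f = 2 * t' := by
    rw [ht', Nat.cast_mul, show 2 * ((f : ℤ) * t') = f * (2 * t') by ring, Int.mul_ediv_cancel_left _ hf0]
  rw [hdiv] at hcop
  have hc2 : IsCoprime (f : ℤ) (2 * t') := Int.isCoprime_iff_gcd_eq_one.2 hcop
  have hc4 : IsCoprime (f : ℤ) (4 * t') := by
    rw [show (4 * t' : ℤ) = 2 * (2 * t') by ring]
    exact hf2.mul_right hc2
  have h2t : (2 * t : ℤ) = f * (2 * t') := by rw [ht']; push_cast; ring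
  have h4t : (4 * t : ℤ) = f * (4 * t') := by rw [ht']; push_cast; ring
  have hf2t : (f : ℤ) ∣ 2 * t := ⟨2 * t', h2t⟩
  have h2t'2t : (2 * t' : ℤ) ∣ 2 * t := ⟨f, by rw [h2t]; ring⟩
  have h4t'4t : (4 * t' : ℤ) ∣ 4 * t := ⟨f, by rw [h4t]; ring⟩
  rw [show t / f = t' by rw [ht', Nat.mul_div_cancel_left _ (by omega)], ← natCard_zmod_two_mul_sq_sub_one_dvd ht'0]
  -- lifts: `x mod 2t'` of the lift of `σ` is congruent to it mod `2t'`; the lift of `σ` mod `2t`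
  have hl' : ∀ a : ℤ, (2 * t' : ℤ) ∣ (((a : ZMod (2 * t'))).val : ℤ) - a := fun a ↦ by
    have h0 := natCast_dvd_val_intCast_sub (2 * t') a
    push_cast at h0
    exact h0
  have hl : ∀ a : ℤ, (2 * t : ℤ) ∣ (((a : ZMod (2 * t))).val : ℤ) - a := fun a ↦ by
    have h0 := natCast_dvd_val_intCast_sub (2 * t) a
    push_cast at h0
    exact h0
  -- the map `σ ↦ σ.val mod 2t'`
  have hmem : ∀ σ : {σ : ZMod (2 * t) // (4 * t : ℤ) ∣ (σ.val : ℤ) ^ 2 - 1 ∧ (f : ℤ) ∣ (σ.val : ℤ) - 1},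
      (4 * t' : ℤ) ∣ (((((σ.1.val : ℤ)) : ZMod (2 * t'))).val : ℤ) ^ 2 - 1 := fun σ ↦ by
    have h1 := four_mul_dvd_sq_sub_sq_of_dvd_sub (hl' (σ.1.val : ℤ))
    rw [show (((((σ.1.val : ℤ)) : ZMod (2 * t'))).val : ℤ) ^ 2 - 1 =
      ((((((σ.1.val : ℤ)) : ZMod (2 * t'))).val : ℤ) ^ 2 - (σ.1.val : ℤ) ^ 2) + ((σ.1.val : ℤ) ^ 2 - 1) by ring]
    exact dvd_add h1 (h4t'4t.trans σ.2.1)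
  refine Nat.card_congr (Equiv.ofBijective (fun σ ↦ ⟨(((σ.1.val : ℤ)) : ZMod (2 * t')), hmem σ⟩) ⟨?_, ?_⟩)
  · -- injective: congruent mod `2t'` and both `≡ 1 (mod f)` ⟹ congruent mod `2t = f·2t'`
    rintro ⟨σ₁, h₁, h₁f⟩ ⟨σ₂, h₂, h₂f⟩ h12
    have h3 : (2 * t' : ℤ) ∣ (σ₂.val : ℤ) - σ₁.val := by
      have h4 := congr_arg Subtype.val h12
      have h5 := (ZMod.intCast_eq_intCast_iff_dvd_sub (σ₁.val : ℤ) (σ₂.val : ℤ) (2 * t')).1 h4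
      push_cast at h5
      exact h5
    have h6 : (f : ℤ) ∣ (σ₂.val : ℤ) - σ₁.val := by
      rw [show (σ₂.val : ℤ) - σ₁.val = ((σ₂.val : ℤ) - 1) - ((σ₁.val : ℤ) - 1) by ring]
      exact dvd_sub h₂f h₁f
    have h7 : (2 * t : ℤ) ∣ (σ₂.val : ℤ) - σ₁.val := h2t ▸ hc2.mul_dvd h6 h3
    exact Subtype.ext (eq_of_dvd_val_sub_val (2 * t) (by push_cast; exact h7))
  · -- surjective: Chinese remainder `x ≡ u (mod 2t')`, `x ≡ 1 (mod f)`
    rintro ⟨u, hu⟩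
    have hco : Nat.Coprime (2 * t') f := by
      have h1 := Int.isCoprime_iff_gcd_eq_one.1 hc2.symm
      rwa [show (2 * t' : ℤ) = ((2 * t' : ℕ) : ℤ) by push_cast; ring, Int.gcd_natCast_natCast] at h1
    obtain ⟨x, hx1, hx2⟩ := Nat.chineseRemainder hco u.val 1
    have hx1' : (2 * t' : ℤ) ∣ (x : ℤ) - u.val := by
      have h1 := (Nat.modEq_iff_dvd.1 hx1.symm)
      push_cast at h1
      exact h1
    have hx2' : (f : ℤ) ∣ (x : ℤ) - 1 := by
      have h1 := (Nat.modEq_iff_dvd.1 hx2.symm)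
      push_cast at h1
      exact h1
    -- the preimage `σ = x mod 2t`
    have hσx : (2 * t : ℤ) ∣ ((((x : ℤ) : ZMod (2 * t))).val : ℤ) - x := hl x
    have hσf : (f : ℤ) ∣ ((((x : ℤ) : ZMod (2 * t))).val : ℤ) - 1 := by
      rw [show ((((x : ℤ) : ZMod (2 * t))).val : ℤ) - 1 = (((((x : ℤ) : ZMod (2 * t))).val : ℤ) - x) + ((x : ℤ) - 1) by
        ring]
      exact dvd_add (hf2t.trans hσx) hx2'
    have hσu : (2 * t' : ℤ) ∣ ((((x : ℤ) : ZMod (2 * t))).val : ℤ) - u.val := by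
      rw [show ((((x : ℤ) : ZMod (2 * t))).val : ℤ) - u.val = (((((x : ℤ) : ZMod (2 * t))).val : ℤ) - x) + ((x : ℤ) - u.val)
        by ring]
      exact dvd_add (h2t'2t.trans hσx) hx1'
    have hσ4 : (4 * t : ℤ) ∣ ((((x : ℤ) : ZMod (2 * t))).val : ℤ) ^ 2 - 1 := by
      rw [h4t]
      refine hc4.mul_dvd ?_ ?_
      · rw [show ((((x : ℤ) : ZMod (2 * t))).val : ℤ) ^ 2 - 1 =
          (((((x : ℤ) : ZMod (2 * t))).val : ℤ) - 1) * (((((x : ℤ) : ZMod (2 * t))).val : ℤ) + 1) by ring]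
        exact hσf.mul_right _
      · have h1 := four_mul_dvd_sq_sub_sq_of_dvd_sub hσu
        rw [show ((((x : ℤ) : ZMod (2 * t))).val : ℤ) ^ 2 - 1 =
          (((((x : ℤ) : ZMod (2 * t))).val : ℤ) ^ 2 - (u.val : ℤ) ^ 2) + ((u.val : ℤ) ^ 2 - 1) by ring]
        exact dvd_add h1 hu
    refine ⟨⟨(((x : ℤ) : ZMod (2 * t))), hσ4, hσf⟩, Subtype.ext ?_⟩
    change ((((((x : ℤ) : ZMod (2 * t))).val : ℤ)) : ZMod (2 * t')) = u
    exact (eq_of_dvd_val_sub_val (2 * t') (σ₁ := u) (by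
      have h1 := hl' ((((x : ℤ) : ZMod (2 * t))).val : ℤ)
      rw [Nat.cast_mul, Nat.cast_ofNat]
      rw [show ((((((((x : ℤ) : ZMod (2 * t))).val : ℤ)) : ZMod (2 * t'))).val : ℤ) - u.val =
        (((((((((x : ℤ) : ZMod (2 * t))).val : ℤ)) : ZMod (2 * t'))).val : ℤ) - ((((x : ℤ) : ZMod (2 * t))).val : ℤ)) +
          (((((x : ℤ) : ZMod (2 * t))).val : ℤ) - u.val) by ring]
      exact dvd_add h1 hσu)).symm

/-- **`#{x mod 2t : x² ≡ 1 (mod 4t), x ≡ 1 (mod f)} = 2^{ρ(2t/f)}` for `f = 2n` even with `f ∣ 2t`, `(f, 2t/f) = 1`** (then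
`t = nm` with `m = 2t/f` odd, and `x mod 2t ↦ x mod m` is a bijection onto `{y mod m : y² = 1}`, of cardinality `2^{ρ(m)}`:
"`ε(f) = 0` is `f` is even. The last group is well-known"; the printed `δ` is `0` here, see the reading notes).
[cite: GritsenkoHulekSankaran2010Symplectic, §4 proof of Prop. 4.12 (ii)] -/
theorem natCard_sf_eq_two_pow_of_even {t n : ℕ} (ht : 0 < t) (hn : 0 < n) (hft : (2 * n : ℤ) ∣ 2 * t)
    (hcop : Int.gcd (2 * n : ℤ) (2 * t / (2 * n)) = 1) :
    Nat.card {σ : ZMod (2 * t) // (4 * t : ℤ) ∣ (σ.val : ℤ) ^ 2 - 1 ∧ (2 * n : ℤ) ∣ (σ.val : ℤ) - 1} =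
      2 ^ (t / n).primeFactors.card := by
  haveI : NeZero (2 * t) := ⟨by omega⟩
  have hn0 : (2 * n : ℤ) ≠ 0 := by positivity
  -- `t = n m`, `2t/f = m` odd, `(2n, m) = 1`, `(4n, m) = 1`
  obtain ⟨m, hm⟩ : n ∣ t := by
    have h1 : (n : ℤ) ∣ t := Int.dvd_of_mul_dvd_mul_left (by norm_num) hft
    exact_mod_cast h1
  have hm0 : 0 < m := Nat.pos_of_mul_pos_left (hm ▸ ht)
  haveI : NeZero m := ⟨hm0.ne'⟩
  have hdiv : 2 * (t : ℤ) / (2 * n) = m := by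
    rw [hm, Nat.cast_mul, show 2 * ((n : ℤ) * m) = (2 * n) * m by ring, Int.mul_ediv_cancel_left _ hn0]
  rw [hdiv] at hcop
  have hc2 : IsCoprime (2 * n : ℤ) m := Int.isCoprime_iff_gcd_eq_one.2 hcop
  have hmo : Odd m := by
    rcases Nat.even_or_odd m with ⟨j, hj⟩ | hmo
    · exfalso
      have h1 : IsCoprime (2 : ℤ) (m : ℤ) := hc2.of_mul_left_left
      rw [hj, Nat.cast_add, ← two_mul] at h1
      have h2 := Int.isUnit_iff.1 (h1.isUnit_of_dvd' (dvd_refl 2) (dvd_mul_right 2 (j : ℤ)))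
      omega
    · exact hmo
  have hc4 : IsCoprime (4 * n : ℤ) m := by
    rw [show (4 * n : ℤ) = 2 * (2 * n) by ring]
    exact (hc2.of_mul_left_left).mul_left hc2
  have h2t : (2 * t : ℤ) = (2 * n) * m := by rw [hm]; push_cast; ring
  have h4t : (4 * t : ℤ) = (4 * n) * m := by rw [hm]; push_cast; ring
  have hm2t : (m : ℤ) ∣ 2 * t := ⟨2 * n, by rw [h2t]; ring⟩
  have hm4t : (m : ℤ) ∣ 4 * t := ⟨4 * n, by rw [h4t]; ring⟩
  rw [show t / n = m by rw [hm, Nat.mul_div_cancel_left _ hn], ← natCard_sq_eq_one_zmod_of_odd hmo]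
  have hl : ∀ a : ℤ, (2 * t : ℤ) ∣ (((a : ZMod (2 * t))).val : ℤ) - a := fun a ↦ by
    have h0 := natCast_dvd_val_intCast_sub (2 * t) a
    push_cast at h0
    exact h0
  -- `y² = 1` in `ℤ/m` iff `m ∣ a² − 1` for a lift `a`
  have hsq : ∀ a : ℤ, ((a : ZMod m)) ^ 2 = 1 ↔ (m : ℤ) ∣ a ^ 2 - 1 := fun a ↦ by
    rw [← Int.cast_pow, show (1 : ZMod m) = ((1 : ℤ) : ZMod m) by norm_num, ZMod.intCast_eq_intCast_iff_dvd_sub,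
      dvd_sub_comm]
  have hmem : ∀ σ : {σ : ZMod (2 * t) // (4 * t : ℤ) ∣ (σ.val : ℤ) ^ 2 - 1 ∧ (2 * n : ℤ) ∣ (σ.val : ℤ) - 1},
      (((σ.1.val : ℤ)) : ZMod m) ^ 2 = 1 := fun σ ↦ (hsq _).2 (hm4t.trans σ.2.1)
  refine Nat.card_congr (Equiv.ofBijective (fun σ ↦ ⟨(((σ.1.val : ℤ)) : ZMod m), hmem σ⟩) ⟨?_, ?_⟩)
  · -- injective: congruent mod `m` and both `≡ 1 (mod 2n)` ⟹ congruent mod `2t = 2n·m`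
    rintro ⟨σ₁, h₁, h₁f⟩ ⟨σ₂, h₂, h₂f⟩ h12
    have h3 : (m : ℤ) ∣ (σ₂.val : ℤ) - σ₁.val :=
      (ZMod.intCast_eq_intCast_iff_dvd_sub (σ₁.val : ℤ) (σ₂.val : ℤ) m).1 (congr_arg Subtype.val h12)
    have h6 : (2 * n : ℤ) ∣ (σ₂.val : ℤ) - σ₁.val := by
      rw [show (σ₂.val : ℤ) - σ₁.val = ((σ₂.val : ℤ) - 1) - ((σ₁.val : ℤ) - 1) by ring]
      exact dvd_sub h₂f h₁f
    have h7 : (2 * t : ℤ) ∣ (σ₂.val : ℤ) - σ₁.val := h2t ▸ hc2.mul_dvd h6 h3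
    exact Subtype.ext (eq_of_dvd_val_sub_val (2 * t) (by push_cast; exact h7))
  · -- surjective: Chinese remainder `x ≡ y (mod m)`, `x ≡ 1 (mod 2n)`
    rintro ⟨y, hy⟩
    have hco : Nat.Coprime m (2 * n) := by
      have h1 := Int.isCoprime_iff_gcd_eq_one.1 hc2.symm
      rwa [show (2 * n : ℤ) = ((2 * n : ℕ) : ℤ) by push_cast; ring, Int.gcd_natCast_natCast] at h1
    obtain ⟨x, hx1, hx2⟩ := Nat.chineseRemainder hco y.val 1
    have hx1' : (m : ℤ) ∣ (x : ℤ) - y.val := by exact_mod_cast Nat.modEq_iff_dvd.1 hx1.symm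
    have hx2' : (2 * n : ℤ) ∣ (x : ℤ) - 1 := by
      have h1 := Nat.modEq_iff_dvd.1 hx2.symm
      push_cast at h1
      exact h1
    have hy' : (m : ℤ) ∣ (y.val : ℤ) ^ 2 - 1 := by
      refine (hsq _).1 ?_
      rw [Int.cast_natCast, ZMod.natCast_zmod_val, hy]
    have hσx : (2 * t : ℤ) ∣ ((((x : ℤ) : ZMod (2 * t))).val : ℤ) - x := hl x
    have hσf : (2 * n : ℤ) ∣ ((((x : ℤ) : ZMod (2 * t))).val : ℤ) - 1 := by
      rw [show ((((x : ℤ) : ZMod (2 * t))).val : ℤ) - 1 = (((((x : ℤ) : ZMod (2 * t))).val : ℤ) - x) + ((x : ℤ) - 1) by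
        ring]
      exact dvd_add (hft.trans hσx) hx2'
    have hσy : (m : ℤ) ∣ ((((x : ℤ) : ZMod (2 * t))).val : ℤ) - y.val := by
      rw [show ((((x : ℤ) : ZMod (2 * t))).val : ℤ) - y.val = (((((x : ℤ) : ZMod (2 * t))).val : ℤ) - x) + ((x : ℤ) - y.val)
        by ring]
      exact dvd_add (hm2t.trans hσx) hx1'
    have hσ4 : (4 * t : ℤ) ∣ ((((x : ℤ) : ZMod (2 * t))).val : ℤ) ^ 2 - 1 := by
      rw [h4t]
      refine hc4.mul_dvd ?_ ?_
      · -- `x ≡ 1 (mod 2n)` ⟹ `x² − 1 = (x − 1)((x − 1) + 2)` is divisible by `2n · 2`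
        obtain ⟨j, hj⟩ := hσf
        refine ⟨j * (n * j + 1), ?_⟩
        have e1 : ((((x : ℤ) : ZMod (2 * t))).val : ℤ) = 2 * n * j + 1 := by linarith
        rw [e1]
        ring
      · rw [show ((((x : ℤ) : ZMod (2 * t))).val : ℤ) ^ 2 - 1 =
          (((((x : ℤ) : ZMod (2 * t))).val : ℤ) - y.val) * (((((x : ℤ) : ZMod (2 * t))).val : ℤ) + y.val) +
            ((y.val : ℤ) ^ 2 - 1) by ring]
        exact dvd_add (hσy.mul_right _) hy'
    refine ⟨⟨(((x : ℤ) : ZMod (2 * t))), hσ4, hσf⟩, Subtype.ext ?_⟩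
    change ((((((x : ℤ) : ZMod (2 * t))).val : ℤ)) : ZMod m) = y
    rw [← ZMod.natCast_zmod_val y, ← Int.cast_natCast (R := ZMod m) y.val]
    exact ((ZMod.intCast_eq_intCast_iff_dvd_sub _ _ m).2 hσy).symm

end Arithmetic

/-! ### §4 Prop. 4.12 (ii): `|O(L_{2t}, h_d)/Õ(L_{2t}, h_d)| = 2^{ρ(t/f)}` (`f` odd), `= 2^{ρ(2t/f)}` (`f` even), for `w = 1` -/

section Order

variable {M : Type u} [AddCommGroup M] [Module.Finite ℤ M] [Module.Free ℤ M] {B₀ : BilinForm ℤ M} (t : ℕ)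

/-- **Prop. 4.12 (ii), `f` odd: "The factor group `O(L_{2t}, h_d)/Õ(L_{2t}, h_d)` is … of order `2^{ρ(t/f)}` if `f` is
odd"** — for a primitive `h ∈ L = B₀ ⊕ ⟨−2t⟩` with `h² = 2d`, `(h, L) = fℤ`, `f` odd, and `w = ((2t/f, 2d/f), f) = 1`, the
stabiliser `{g ∈ O(L) : g h = h}` has exactly `2^{ρ(t/f)}` distinct actions on `A_L`. `B₀` symmetric even unimodular with two
orthogonal hyperbolic pairs, `t ≥ 1`. [cite: GritsenkoHulekSankaran2010Symplectic, §4 Prop. 4.12 (ii)] -/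
theorem natCard_quot_stabiliser_discriminantGroupCongr_eq_two_pow_of_odd (hu : B₀.IsUnimodular) (hs₀ : B₀.IsSymm)
    (he : B₀.IsEven) (ht : 0 < t) {x y x₁ y₁ : M} (hP : TwoHyperbolicPairs B₀ x y x₁ y₁) {r r' : M × ℤ} {d : ℤ}
    {f : ℕ} (hfo : Odd f) (hw : Int.gcd (Int.gcd (2 * t / f) (2 * d / f) : ℤ) f = 1)
    (hr : B₀.prod ((-(2 * t : ℤ)) • LinearMap.mul ℤ ℤ) r r = 2 * d) (hr0 : r ≠ 0)
    (hsat : ∀ (k : ℤ) (w : M × ℤ), k ≠ 0 → k • w ∈ ℤ ∙ r → w ∈ ℤ ∙ r)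
    (hfr : ∀ z, (f : ℤ) ∣ B₀.prod ((-(2 * t : ℤ)) • LinearMap.mul ℤ ℤ) r z)
    (hr' : B₀.prod ((-(2 * t : ℤ)) • LinearMap.mul ℤ ℤ) r r' = f) :
    Nat.card (Quot fun g g' : {g : (B₀.prod ((-(2 * t : ℤ)) • LinearMap.mul ℤ ℤ)).IsometryEquiv
        (B₀.prod ((-(2 * t : ℤ)) • LinearMap.mul ℤ ℤ)) // g r = r} ↦
        g.1.discriminantGroupCongr = g'.1.discriminantGroupCongr) = 2 ^ (t / f).primeFactors.card := by
  obtain ⟨hf0, hft, hcop, -, -⟩ := divisor_data_of_w_eq_one t hu he ht hw hr hr0 hsat hfr hr'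
  rw [natCard_quot_stabiliser_discriminantGroupCongr_eq t hu hs₀ he ht hP hf0 hr0 hsat hfr hr']
  exact natCard_sf_eq_two_pow_of_odd ht hfo hft hcop

/-- **Prop. 4.12 (ii), `f = 2n` even: "If `f` is even the order is equal to `2^{ρ(2t/f)+δ}`"**, with `δ = 0` (forced by
`w = 1`, reading notes) — for a primitive `h ∈ L = B₀ ⊕ ⟨−2t⟩` with `h² = 2d`, `(h, L) = 2nℤ` and `w = 1`, the stabiliser
`{g ∈ O(L) : g h = h}` has exactly `2^{ρ(t/n)}` (`t/n = 2t/f`) distinct actions on `A_L`.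
[cite: GritsenkoHulekSankaran2010Symplectic, §4 Prop. 4.12 (ii)] -/
theorem natCard_quot_stabiliser_discriminantGroupCongr_eq_two_pow_of_even (hu : B₀.IsUnimodular) (hs₀ : B₀.IsSymm)
    (he : B₀.IsEven) (ht : 0 < t) {x y x₁ y₁ : M} (hP : TwoHyperbolicPairs B₀ x y x₁ y₁) {r r' : M × ℤ} {d : ℤ}
    {n : ℕ} (hn : 0 < n) (hw : Int.gcd (Int.gcd (2 * t / (2 * n)) (2 * d / (2 * n)) : ℤ) (2 * n) = 1)
    (hr : B₀.prod ((-(2 * t : ℤ)) • LinearMap.mul ℤ ℤ) r r = 2 * d) (hr0 : r ≠ 0)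
    (hsat : ∀ (k : ℤ) (w : M × ℤ), k ≠ 0 → k • w ∈ ℤ ∙ r → w ∈ ℤ ∙ r)
    (hfr : ∀ z, (2 * n : ℤ) ∣ B₀.prod ((-(2 * t : ℤ)) • LinearMap.mul ℤ ℤ) r z)
    (hr' : B₀.prod ((-(2 * t : ℤ)) • LinearMap.mul ℤ ℤ) r r' = 2 * n) :
    Nat.card (Quot fun g g' : {g : (B₀.prod ((-(2 * t : ℤ)) • LinearMap.mul ℤ ℤ)).IsometryEquiv
        (B₀.prod ((-(2 * t : ℤ)) • LinearMap.mul ℤ ℤ)) // g r = r} ↦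
        g.1.discriminantGroupCongr = g'.1.discriminantGroupCongr) = 2 ^ (t / n).primeFactors.card := by
  obtain ⟨hf0, hft, hcop, -, -⟩ := divisor_data_of_w_eq_one t hu he ht hw hr hr0 hsat hfr hr'
  rw [natCard_quot_stabiliser_discriminantGroupCongr_eq t hu hs₀ he ht hP hf0 hr0 hsat hfr hr']
  exact natCard_sf_eq_two_pow_of_even ht hn hft hcop

end Order

/-! ### §5 The models `(E₈(−1)^{⊕m} ⊕ U^{⊕(k+2)}) ⊕ ℤ(−2t)` (`L_{2t}`: `m = 2`, `k = 1`) -/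

section Model

variable (m k t : ℕ)

/-- **`|O(L, h)/Õ(L, h)| = #{x mod 2t : x² ≡ 1 (4t), x ≡ 1 (f)}` in the models** `(E₈(−1)^{⊕m} ⊕ U^{⊕(k+2)}) ⊕ ℤ(−2t)`, for every
primitive `h` with `(h, L) = fℤ`. [cite: GritsenkoHulekSankaran2010Symplectic, §4 Prop. 4.12 (ii) and proof] -/
theorem natCard_quot_stabiliser_discriminantGroupCongr_model_eq (ht : 0 < t)
    {r r' : ((Fin m → Fin 8 → ℤ) × ((Fin (k + 2) → ℤ) × (Fin (k + 2) → ℤ))) × ℤ} {f : ℤ} (hf0 : f ≠ 0) (hr0 : r ≠ 0)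
    (hsat : ∀ (a : ℤ) (w : ((Fin m → Fin 8 → ℤ) × ((Fin (k + 2) → ℤ) × (Fin (k + 2) → ℤ))) × ℤ), a ≠ 0 →
      a • w ∈ ℤ ∙ r → w ∈ ℤ ∙ r)
    (hfr : ∀ z, f ∣ (((LinearMap.BilinForm.pi fun _ : Fin m ↦ -e8Form).prod (hyperbolicSum (k + 2))).prod
      ((-(2 * t : ℤ)) • LinearMap.mul ℤ ℤ)) r z)
    (hr' : (((LinearMap.BilinForm.pi fun _ : Fin m ↦ -e8Form).prod (hyperbolicSum (k + 2))).prod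
      ((-(2 * t : ℤ)) • LinearMap.mul ℤ ℤ)) r r' = f) :
    Nat.card (Quot fun g g' : {g : ((((LinearMap.BilinForm.pi fun _ : Fin m ↦ -e8Form).prod (hyperbolicSum (k + 2))).prod
        ((-(2 * t : ℤ)) • LinearMap.mul ℤ ℤ))).IsometryEquiv
        ((((LinearMap.BilinForm.pi fun _ : Fin m ↦ -e8Form).prod (hyperbolicSum (k + 2))).prod
        ((-(2 * t : ℤ)) • LinearMap.mul ℤ ℤ))) // g r = r} ↦ g.1.discriminantGroupCongr = g'.1.discriminantGroupCongr) =
      Nat.card {σ : ZMod (2 * t) // (4 * t : ℤ) ∣ (σ.val : ℤ) ^ 2 - 1 ∧ f ∣ (σ.val : ℤ) - 1} := by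
  obtain ⟨hsB, heB, huB⟩ := isSymm_isEven_isUnimodular_pi_neg_e8Form_prod_hyperbolicSum' m (k + 2)
  exact natCard_quot_stabiliser_discriminantGroupCongr_eq t huB hsB heB ht
    (twoHyperbolicPairs_pi_neg_e8Form_prod_hyperbolicSum_add_two m k) hf0 hr0 hsat hfr hr'

/-- **Prop. 4.12 (ii), `f` odd, in the models**: `2^{ρ(t/f)}` distinct actions of the stabiliser on `A_L` (`w = 1`).
[cite: GritsenkoHulekSankaran2010Symplectic, §4 Prop. 4.12 (ii)] -/
theorem natCard_quot_stabiliser_discriminantGroupCongr_model_eq_two_pow_of_odd (ht : 0 < t)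
    {r r' : ((Fin m → Fin 8 → ℤ) × ((Fin (k + 2) → ℤ) × (Fin (k + 2) → ℤ))) × ℤ} {d : ℤ} {f : ℕ} (hfo : Odd f)
    (hw : Int.gcd (Int.gcd (2 * t / f) (2 * d / f) : ℤ) f = 1)
    (hr : (((LinearMap.BilinForm.pi fun _ : Fin m ↦ -e8Form).prod (hyperbolicSum (k + 2))).prod
      ((-(2 * t : ℤ)) • LinearMap.mul ℤ ℤ)) r r = 2 * d) (hr0 : r ≠ 0)
    (hsat : ∀ (a : ℤ) (w : ((Fin m → Fin 8 → ℤ) × ((Fin (k + 2) → ℤ) × (Fin (k + 2) → ℤ))) × ℤ), a ≠ 0 →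
      a • w ∈ ℤ ∙ r → w ∈ ℤ ∙ r)
    (hfr : ∀ z, (f : ℤ) ∣ (((LinearMap.BilinForm.pi fun _ : Fin m ↦ -e8Form).prod (hyperbolicSum (k + 2))).prod
      ((-(2 * t : ℤ)) • LinearMap.mul ℤ ℤ)) r z)
    (hr' : (((LinearMap.BilinForm.pi fun _ : Fin m ↦ -e8Form).prod (hyperbolicSum (k + 2))).prod
      ((-(2 * t : ℤ)) • LinearMap.mul ℤ ℤ)) r r' = f) :
    Nat.card (Quot fun g g' : {g : ((((LinearMap.BilinForm.pi fun _ : Fin m ↦ -e8Form).prod (hyperbolicSum (k + 2))).prod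
        ((-(2 * t : ℤ)) • LinearMap.mul ℤ ℤ))).IsometryEquiv
        ((((LinearMap.BilinForm.pi fun _ : Fin m ↦ -e8Form).prod (hyperbolicSum (k + 2))).prod
        ((-(2 * t : ℤ)) • LinearMap.mul ℤ ℤ))) // g r = r} ↦ g.1.discriminantGroupCongr = g'.1.discriminantGroupCongr) =
      2 ^ (t / f).primeFactors.card := by
  obtain ⟨hsB, heB, huB⟩ := isSymm_isEven_isUnimodular_pi_neg_e8Form_prod_hyperbolicSum' m (k + 2)
  exact natCard_quot_stabiliser_discriminantGroupCongr_eq_two_pow_of_odd t huB hsB heB ht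
    (twoHyperbolicPairs_pi_neg_e8Form_prod_hyperbolicSum_add_two m k) hfo hw hr hr0 hsat hfr hr'

/-- **Prop. 4.12 (ii), `f = 2n` even, in the models**: `2^{ρ(2t/f)}` distinct actions of the stabiliser on `A_L` (`w = 1`).
[cite: GritsenkoHulekSankaran2010Symplectic, §4 Prop. 4.12 (ii)] -/
theorem natCard_quot_stabiliser_discriminantGroupCongr_model_eq_two_pow_of_even (ht : 0 < t)
    {r r' : ((Fin m → Fin 8 → ℤ) × ((Fin (k + 2) → ℤ) × (Fin (k + 2) → ℤ))) × ℤ} {d : ℤ} {n : ℕ} (hn : 0 < n)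
    (hw : Int.gcd (Int.gcd (2 * t / (2 * n)) (2 * d / (2 * n)) : ℤ) (2 * n) = 1)
    (hr : (((LinearMap.BilinForm.pi fun _ : Fin m ↦ -e8Form).prod (hyperbolicSum (k + 2))).prod
      ((-(2 * t : ℤ)) • LinearMap.mul ℤ ℤ)) r r = 2 * d) (hr0 : r ≠ 0)
    (hsat : ∀ (a : ℤ) (w : ((Fin m → Fin 8 → ℤ) × ((Fin (k + 2) → ℤ) × (Fin (k + 2) → ℤ))) × ℤ), a ≠ 0 →
      a • w ∈ ℤ ∙ r → w ∈ ℤ ∙ r)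
    (hfr : ∀ z, (2 * n : ℤ) ∣ (((LinearMap.BilinForm.pi fun _ : Fin m ↦ -e8Form).prod (hyperbolicSum (k + 2))).prod
      ((-(2 * t : ℤ)) • LinearMap.mul ℤ ℤ)) r z)
    (hr' : (((LinearMap.BilinForm.pi fun _ : Fin m ↦ -e8Form).prod (hyperbolicSum (k + 2))).prod
      ((-(2 * t : ℤ)) • LinearMap.mul ℤ ℤ)) r r' = 2 * n) :
    Nat.card (Quot fun g g' : {g : ((((LinearMap.BilinForm.pi fun _ : Fin m ↦ -e8Form).prod (hyperbolicSum (k + 2))).prod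
        ((-(2 * t : ℤ)) • LinearMap.mul ℤ ℤ))).IsometryEquiv
        ((((LinearMap.BilinForm.pi fun _ : Fin m ↦ -e8Form).prod (hyperbolicSum (k + 2))).prod
        ((-(2 * t : ℤ)) • LinearMap.mul ℤ ℤ))) // g r = r} ↦ g.1.discriminantGroupCongr = g'.1.discriminantGroupCongr) =
      2 ^ (t / n).primeFactors.card := by
  obtain ⟨hsB, heB, huB⟩ := isSymm_isEven_isUnimodular_pi_neg_e8Form_prod_hyperbolicSum' m (k + 2)
  exact natCard_quot_stabiliser_discriminantGroupCongr_eq_two_pow_of_even t huB hsB heB ht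
    (twoHyperbolicPairs_pi_neg_e8Form_prod_hyperbolicSum_add_two m k) hn hw hr hr0 hsat hfr hr'

end Model

end Literature.Topology.FourManifolds
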